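import Literature.MathematicalPhysics.QuantumFieldTheory.Balaban1983to89.BlockAveragingEMLAnalyticMean
import Literature.MathematicalPhysics.QuantumFieldTheory.Balaban1983to89.B10Eq27TorusAxialLog
import Literature.MathematicalPhysics.QuantumFieldTheory.Balaban1983to89.B6SectAOperatorsV1
import HarnessLib

/-!
# Route `UnitScaleTilt`, crux K1 «MinimiserStabilityRegPr» (stmt-QuantumFields-19200), leaf V2′ `stub_halvingStep` — pillar P3 `ChartPerLevel`,
# DEFINITIONS FILE: **THE MULTI-LEVEL (0.4)-CONSTRAINT MAP OF THE CUBE PROBLEM IN THE LOGARITHMIC CHART AT BACKGROUND 1**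
# ([Balaban1985Variational] (154)–(157): «Q_j(ηA) = B on Λ′_j, j = 0, 1, …, k», for the family's (0.4) averaging of [Balaban1987RG1])

Cell `ym3-torus` ∕ fleet seat `ym-ust-19200-p2` g5 (v8 PEN; OWNER RULING g21-№5 §4 (3): «★19200-p2 lineage: P0 (ii) file + P3 `𝒬` Defs file + P3 text»).
WHY.  Pillar P3 of the v8 re-cut pins the ABSTRACT chart data of the F4 pen's `FlatSmallSolution158CubeSeq.chart47_dom` (`C : (PBond (F.P K) 0 → V) → (β′ → V)`,
quadratic bound `hCq`, holomorphy `hCd`, `Qlin ∘ H = id`) to the TRUE k-fold (0.4)-descent of the family read level by level on the constraint index set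
`β′ := B6SectAOperatorsV1.BondIdx D` of a nested domain family `D` (the cube sequence (144), `FlatCubeSequence.cubeSeqT3`).  The (0.4) average of the tree
(`BlockAveraging.blockAvg ℰp`) is a GUARDED map on `SU(N)`-valued fields; the chart needs its ANALYTIC CONTINUATION to fields with values in the units of
`𝔤ᶜ = M_N(ℂ)` ([Balaban1987RG1] p.253 «It is a Gᶜ-valued function … we assume that it is an analytic function») composed with `A ↦ e^{iηA}` and read
through `(iηLʲ)⁻¹ log` at the index bonds.  This file supplies exactly these DEFINITIONS (no estimate):
* `expCfg η A` — the configuration `b ↦ e^{iηA(b)}` in the units of a complete normed `ℂ`-algebra `𝔸` ([Balaban1985Variational] (152): `U₁ = e^{iηA}`);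
* `emlAvgU` — the UNGUARDED (0.4) average on `𝔸ˣ`-valued fields: `Ū(c) = eml{U(Γ ∪ [x,x′] ∪ (−Γ′) ∪ (−c))}·U(c)` with the printed `exp[mean log]`
  (`ExpMeanLog.eml`, analytic on `‖W_i − 1‖ < 1`) and NO small-field guard (the guard of `BlockAveraging.corr` is what makes the `SU(N)` map total but
  non-analytic); loops and straight transporters are the torus transports `B10Eq27TorusAxialLog.holT` along the words of `BlockAveraging.loopWord`;
* `emlIterU k` — its `k`-fold iterate `T^{(0)} → T^{(k)}` ([Balaban1987RG1] (0.11));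
* `chartQ η D A : BondIdx D → 𝔸` — **`𝒬(A)(j, c) := (iηLʲ)⁻¹·log (Ū^{(j)}(c))`, `Ū^{(j)} = emlIterU j (expCfg η A)`**, at every constraint index `(j, c)`,
  `c ∈ Λ_j` (level `0` included: there `𝒬(A)(0, b) = A(b)` on the guard of `log`, the frozen exterior of (150)); so «`U = e^{iηA}` lies in the cube space (150)
  with data `V″ = e^{iηLʲB}`» reads `𝒬(A) = B` ((156) «LʲηQ_jA′ = B on Λ′_j» in the (0.4) reading), and P3's `C := 𝒬 − D𝒬(0)` is its nonlinear part.
Sanity (proved): `expCfg η 0 = 1`, `emlAvgU 1 = 1`, `emlIterU k 1 = 1`, `chartQ η D 0 = 0` (the flat point is the origin of the chart).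
Sanity (proved): §4 the BRIDGE «on `SU(N)` fields whose (0.4) loop variables at `c` are `δ_N`-small, the matrix of `emlAvgU` of the field read in
`M_N(ℂ)ˣ` IS the matrix of the tree's `avgFun ℰp`» (`coe_emlAvgU_unitsField`).
HONEST SCOPE.  Definitions + flat-point values + the one-step bridge only.  NOT proved here (successor targets, named): (a) the k-fold bridge
(`emlIterU k ∘ coe = coe ∘ Averaging.iter (blockAvg ℰp) k` on fields with small iterated averages — one-step bridge + induction); (b) the linearisation
`D𝒬(0)(j, ·) = L^{−j}·Q^{(j)} = bondAvgIter j − L^{−j}dΛ_j` (this lineage's p519475/p522364, junction G3 of the vet); (c) the k-UNIFORM weighted remainder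
and holomorphy letters `hCq`/`hCd` (= pillar P3's content, [Balaban1985Variational] (44)/(47), [Balaban1985Averaging] Props. 3–4).  NOT a claim about the
mass gap.

References: T. Bałaban, CMP **102** (1985) 277–309 [Balaban1985Variational] ((44)–(48) p.287, (152)–(157) pp.301–302); CMP **109** (1987) 249–301
[Balaban1987RG1] ((0.4)–(0.11) p.253); CMP **96** (1984) 223–250 [Balaban1984PropagatorsII] ((2.3), (2.6), (2.20) pp.224–226).
-/

noncomputable section

open scoped BigOperators
open NormedSpace

namespace Summit.QuantumFields.YangMills.Theorems.Prop8Chart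

open Literature.MathematicalPhysics.QuantumFieldTheory.Balaban1983to89
open T4Continuum BlockAveraging ExpMeanLog MatrixLog
open B10Eq27TorusAxialLog (holT holT_nil holT_cons_true holT_cons_false holT_one)
open B6SectADomainsV1 (Domains)
open B6SectAOperatorsV1 (BondIdx)

variable {P : Params} {𝔸 : Type*} [NormedRing 𝔸] [NormedAlgebra ℂ 𝔸] [CompleteSpace 𝔸]

/-! ## §1 `e^{iηA}` as a configuration in the units of `𝔸` -/

/-- `e^{iηa}` is a unit of the complete normed algebra (an exponential). [cite: Balaban1985Variational, (152) p.301] -/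
theorem isUnit_exp_I_eta (η : ℝ) (a : 𝔸) : IsUnit (exp ((Complex.I * (η : ℂ)) • a)) := by
  letI : NormedAlgebra ℚ 𝔸 := NormedAlgebra.restrictScalars ℚ ℂ 𝔸
  exact isUnit_exp _

/-- **THE CHARTED CONFIGURATION `U = e^{iηA}`** ([Balaban1985Variational] (152): «U₁ = e^{iηA}», `η = L^{−k}`): bondwise `b ↦ e^{iηA(b)}` in `𝔸ˣ`.
[cite: Balaban1985Variational, (152) p.301] -/
def expCfg (η : ℝ) (A : PBond P 0 → 𝔸) : GaugeField P 0 𝔸ˣ := fun b => (isUnit_exp_I_eta η (A b)).unit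

/-- the value of a charted bond variable. [cite: Balaban1985Variational, (152) p.301] -/
@[simp] theorem coe_expCfg (η : ℝ) (A : PBond P 0 → 𝔸) (b : PBond P 0) :
    ((expCfg η A b : 𝔸ˣ) : 𝔸) = exp ((Complex.I * (η : ℂ)) • A b) := rfl

/-- the origin of the chart is the flat configuration: `e^{iη·0} = 1`. [cite: Balaban1985Variational, (152) p.301] -/
@[simp] theorem expCfg_zero (η : ℝ) : expCfg (P := P) η (0 : PBond P 0 → 𝔸) = fun _ => 1 := by
  funext b
  apply Units.ext
  rw [coe_expCfg, Pi.zero_apply, smul_zero, exp_zero, Units.val_one]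

/-! ## §2 The unguarded (0.4) average on `𝔸ˣ`-valued fields and its iterate -/

section Avg

variable {j : ℕ}

/-- The (0.4) LOOP VARIABLES `U(Γ ∪ [x,x′] ∪ (−Γ′) ∪ (−c))` of an `𝔸ˣ`-valued field at the coarse bond `c` (index `i = (n, σ, σ′)`; the words of
`BlockAveraging.loopWord`, transported by `B10Eq27TorusAxialLog.holT` from the block centre). [cite: Balaban1987RG1, (0.4) p.253] -/
def loopHolU (U : GaugeField P j 𝔸ˣ) (c : PBond P (j + 1)) (i : Idx P) : 𝔸ˣ :=
  holT U (emb c.src) (loopWord P.L c.dir (off i.1) i.2.1 i.2.2)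

/-- **THE UNGUARDED (0.4) AVERAGE** `Ū(c) = exp[|I|⁻¹ Σ_i log U(loop_i)]·U(c)` on `𝔸ˣ`-valued fields: the printed `exp[mean log]` (`ExpMeanLog.eml`, a unit by
`isUnit_eml`) of the loop variables times the straight transporter of `L` steps — the analytic continuation of the tree's guarded `SU(N)` map
`BlockAveraging.avgFun ℰp` ([Balaban1987RG1] p.253 «It is a Gᶜ-valued function … analytic»). [cite: Balaban1987RG1, (0.4) p.253] -/
def emlAvgU (U : GaugeField P j 𝔸ˣ) : GaugeField P (j + 1) 𝔸ˣ := fun c =>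
  (isUnit_eml (fun i : Idx P => ((loopHolU U c i : 𝔸ˣ) : 𝔸))).unit * holT U (emb c.src) (List.replicate P.L (c.dir, true))

/-- the value of the averaged bond variable. [cite: Balaban1987RG1, (0.4) p.253] -/
theorem coe_emlAvgU (U : GaugeField P j 𝔸ˣ) (c : PBond P (j + 1)) :
    ((emlAvgU U c : 𝔸ˣ) : 𝔸) = eml (fun i : Idx P => ((loopHolU U c i : 𝔸ˣ) : 𝔸)) * ((holT U (emb c.src) (List.replicate P.L (c.dir, true)) : 𝔸ˣ) : 𝔸) := by
  rw [emlAvgU, Units.val_mul, IsUnit.unit_spec]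

omit [CompleteSpace 𝔸] in
/-- `eml` of the constant family `1` is `1`. [cite: Balaban1987RG1, (0.4) p.253] -/
theorem eml_const_one {ι : Type*} [Fintype ι] : eml (fun _ : ι => (1 : 𝔸)) = 1 := by
  rw [eml_eq_exp]
  simp [mlog_one, exp_zero]

/-- the flat field averages to the flat field. [cite: Balaban1987RG1, (0.4) p.253] -/
@[simp] theorem emlAvgU_one : emlAvgU (P := P) (j := j) (fun _ : PBond P j => (1 : 𝔸ˣ)) = fun _ => 1 := by
  funext c
  apply Units.ext
  rw [coe_emlAvgU]
  have h1 : (fun i : Idx P => ((loopHolU (fun _ : PBond P j => (1 : 𝔸ˣ)) c i : 𝔸ˣ) : 𝔸)) = fun _ => 1 := by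
    funext i; rw [loopHolU, holT_one]; rfl
  rw [h1, eml_const_one, holT_one]
  simp

end Avg

/-- **THE `k`-FOLD UNGUARDED (0.4) AVERAGE** `Ū^{(k)}`, `T^{(0)} → T^{(k)}`. [cite: Balaban1987RG1, (0.11) p.253] -/
def emlIterU : (k : ℕ) → GaugeField P 0 𝔸ˣ → GaugeField P k 𝔸ˣ
  | 0 => fun U => U
  | k + 1 => fun U => emlAvgU (emlIterU k U)

/-- no averaging. [cite: Balaban1987RG1, (0.11) p.253] -/
@[simp] theorem emlIterU_zero (U : GaugeField P 0 𝔸ˣ) : emlIterU 0 U = U := rfl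

/-- one more level. [cite: Balaban1987RG1, (0.11) p.253] -/
theorem emlIterU_succ (k : ℕ) (U : GaugeField P 0 𝔸ˣ) : emlIterU (k + 1) U = emlAvgU (emlIterU k U) := rfl

/-- the flat field is fixed by every iterate. [cite: Balaban1987RG1, (0.11) p.253] -/
@[simp] theorem emlIterU_one : ∀ k : ℕ, emlIterU (P := P) k (fun _ : PBond P 0 => (1 : 𝔸ˣ)) = fun _ => 1
  | 0 => rfl
  | k + 1 => by rw [emlIterU_succ, emlIterU_one k, emlAvgU_one]

/-! ## §3 The multi-level constraint map in the chart -/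

/-- **THE MULTI-LEVEL (0.4)-CONSTRAINT MAP IN THE LOGARITHMIC CHART AT BACKGROUND 1**: for a nested domain family `D` ([Balaban1984PropagatorsII]
(2.1)–(2.4); the cube sequence (144)) and `η` (print: `L^{−k}`), at every constraint index `(j, c)`, `c ∈ Λ_j` (`B6SectAOperatorsV1.BondIdx D`, level `0`
= the frozen exterior included): `𝒬(A)(j, c) := (iηLʲ)⁻¹·log((emlIterU j (e^{iηA}))(c))` — so that «`e^{iηA}` has the multi-level (0.4)-data `e^{iηLʲB}` on
`Λ_j`» reads `𝒬(A) = B` ([Balaban1985Variational] (156) «LʲηQ_jA′ = B on Λ′_j, j = 0, 1, …, k», (0.4) reading); pillar P3's chart remainder is `C := 𝒬 − D𝒬(0)`.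
[cite: Balaban1985Variational, (156) p.302; Balaban1984PropagatorsII, (2.20) p.226] -/
def chartQ (η : ℝ) (D : Domains P) (A : PBond P 0 → 𝔸) : BondIdx D → 𝔸 := fun i =>
  ((Complex.I * (η : ℂ) * ((P.L : ℂ) ^ (i.1.1 : ℕ)))⁻¹) • mlog (((emlIterU (i.1.1 : ℕ) (expCfg η A)) i.1.2 : 𝔸ˣ) : 𝔸)

/-- `𝒬` unfolded at an index. [cite: Balaban1985Variational, (156) p.302] -/
theorem chartQ_apply (η : ℝ) (D : Domains P) (A : PBond P 0 → 𝔸) (i : BondIdx D) :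
    chartQ η D A i = ((Complex.I * (η : ℂ) * ((P.L : ℂ) ^ (i.1.1 : ℕ)))⁻¹) • mlog (((emlIterU (i.1.1 : ℕ) (expCfg η A)) i.1.2 : 𝔸ˣ) : 𝔸) := rfl

/-- **THE FLAT POINT IS THE ORIGIN OF THE CHART**: `𝒬(0) = 0` (all multi-level data of the flat field are `1`, `log 1 = 0`).
[cite: Balaban1985Variational, (156) p.302] -/
@[simp] theorem chartQ_zero (η : ℝ) (D : Domains P) : chartQ η D (0 : PBond P 0 → 𝔸) = 0 := by
  funext i
  rw [chartQ_apply, expCfg_zero, emlIterU_one, Pi.zero_apply, Units.val_one, mlog_one, smul_zero]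

/-! ## §4 The bridge to the tree's guarded `SU(N)` average on the guard -/

section Bridge

open scoped Matrix.Norms.L2Operator
open B10Eq27TorusAxialLog (unitsField toUField val_holT_unitsField holT_toUField val_suIncl holT_eq_holAt)

omit [CompleteSpace 𝔸] in
/-- `eml` is invariant under reindexing by a bijection of index types (the weights `|I|⁻¹` and the sum of logarithms are). [cite: Balaban1987RG1, (0.7) p.253] -/
theorem eml_comp_equiv' {ι ι' : Type*} [Fintype ι] [Fintype ι'] (W : ι → 𝔸) (e : ι' ≃ ι) : eml (W ∘ e) = eml W := by
  rw [eml_eq_exp, eml_eq_exp, Fintype.card_congr e]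
  simp only [Function.comp_apply]
  rw [Equiv.sum_comp e (fun i => mlog (W i))]

variable {N : ℕ} [NeZero N] {j : ℕ}

/-- The loop variables of the `SU(N)` field read in the units of `M_N(ℂ)` are the tree's (0.4) loop variables (`BlockAveraging.loopHol`) as matrices.
[cite: Balaban1987RG1, (0.4) p.253] -/
theorem coe_loopHolU_unitsField (U : GaugeField P j (Matrix.specialUnitaryGroup (Fin N) ℂ)) (c : PBond P (j + 1)) (i : Idx P) :
    ((loopHolU (unitsField (toUField U)) c i : (Matrix (Fin N) (Fin N) ℂ)ˣ) : Matrix (Fin N) (Fin N) ℂ) =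
      ((loopHol U c i : Matrix.specialUnitaryGroup (Fin N) ℂ) : Matrix (Fin N) (Fin N) ℂ) := by
  rw [loopHolU, val_holT_unitsField, holT_toUField, val_suIncl, holT_eq_holAt]
  rfl

/-- **ON THE GUARD, THE UNGUARDED AVERAGE IS THE TREE'S (0.4) AVERAGE**: for an `SU(N)`-valued field whose (0.4) loop variables at `c` are `δ_N`-small
(`BlockAveraging.Small ℰp U c`), the matrix of `(avgFun ℰp U)(c)` equals the matrix of `emlAvgU` of the same field read in `M_N(ℂ)ˣ` — so `emlAvgU`
IS the analytic continuation of the family's averaging off the guard's boundary. [cite: Balaban1987RG1, (0.4) p.253] -/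
theorem coe_emlAvgU_unitsField (U : GaugeField P j (Matrix.specialUnitaryGroup (Fin N) ℂ)) (c : PBond P (j + 1))
    (hsmall : Small (expMeanLogSU (n := Fin N)) U c) :
    ((emlAvgU (unitsField (toUField U)) c : (Matrix (Fin N) (Fin N) ℂ)ˣ) : Matrix (Fin N) (Fin N) ℂ) =
      ((avgFun (expMeanLogSU (n := Fin N)) U c : Matrix.specialUnitaryGroup (Fin N) ℂ) : Matrix (Fin N) (Fin N) ℂ) := by
  rw [coe_emlAvgU]
  have hloop : (fun i : Idx P => ((loopHolU (unitsField (toUField U)) c i : (Matrix (Fin N) (Fin N) ℂ)ˣ) : Matrix (Fin N) (Fin N) ℂ)) =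
      fun i => ((loopHol U c i : Matrix.specialUnitaryGroup (Fin N) ℂ) : Matrix (Fin N) (Fin N) ℂ) := by
    funext i; exact coe_loopHolU_unitsField U c i
  have hstraight : ((holT (unitsField (toUField U)) (emb c.src) (List.replicate P.L (c.dir, true)) : (Matrix (Fin N) (Fin N) ℂ)ˣ) :
      Matrix (Fin N) (Fin N) ℂ) = ((AveragingRT.axialAvg U c : Matrix.specialUnitaryGroup (Fin N) ℂ) : Matrix (Fin N) (Fin N) ℂ) := by
    rw [val_holT_unitsField, holT_toUField, val_suIncl, holT_eq_holAt, ← axialAvg_eq_holAt_walk]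
  rw [hloop, hstraight]
  -- the guarded side
  have havg : avgFun (expMeanLogSU (n := Fin N)) U c = corr (expMeanLogSU (n := Fin N)) U c * AveragingRT.axialAvg U c := rfl
  rw [havg, Submonoid.coe_mul]
  congr 1
  unfold corr
  rw [if_pos hsmall]
  unfold LoopAverage.avg
  have h := BlockAveragingEMLAnalyticMean.coe_expMeanLogSU_E_eq_eml (loopHol U c ∘ ⇑(LoopAverage.enum (Idx P)).symm) (fun i => hsmall _)
  rw [h]
  exact (eml_comp_equiv' (fun i : Idx P => ((loopHol U c i : Matrix.specialUnitaryGroup (Fin N) ℂ) : Matrix (Fin N) (Fin N) ℂ))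
    (LoopAverage.enum (Idx P)).symm).symm

end Bridge

/-! ## §5 (v1.1, APPEND-ONLY — §1–§4 byte-identical) Print's `(1/i)·log` reading of the multi-level data -/

section PrintReading

/-- **THE MULTI-LEVEL DATA IN PRINT'S NORMALISATION** `B(j, c) := (1/i)·log((Ū^{(j)})(c))`, `Ū^{(j)} = emlIterU j (e^{iηA})` ([Balaban1985Variational] (155)
«V₁ = e^{iB}», (156)–(157) «Q_j(ηA) = B on Λ′_j … or simply 𝐐(A) = B», «LʲηQ_jA′ = B on Λ′_j») — the reading in which the LINEAR part is the tree's multi-scale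
constraint operator WITH its factors `Lʲη` (`B6SectAOperatorsV1.QE`, `FlatCubeOperators.QE_hOp`: «(45) LʲηQ_jHB = B») and in which the F4 pen's `chart47_dom`
letters (`Qlin (H X) = X`, `w 1 b·‖H X b‖ ≤ B₀·t` with `w 1 b = L^{j(b)}η`) are written; `chartQ` of §3 is the `A`-normalised reading
`chartQ = (ηLʲ)⁻¹·chartLog` (`chartLog_eq_smul_chartQ`). [cite: Balaban1985Variational, (155)-(157) p.302] -/
def chartLog (η : ℝ) (D : Domains P) (A : PBond P 0 → 𝔸) : BondIdx D → 𝔸 := fun i =>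
  (-Complex.I) • mlog (((emlIterU (i.1.1 : ℕ) (expCfg η A)) i.1.2 : 𝔸ˣ) : 𝔸)

/-- `chartLog` unfolded at an index. [cite: Balaban1985Variational, (156) p.302] -/
theorem chartLog_apply (η : ℝ) (D : Domains P) (A : PBond P 0 → 𝔸) (i : BondIdx D) :
    chartLog η D A i = (-Complex.I) • mlog (((emlIterU (i.1.1 : ℕ) (expCfg η A)) i.1.2 : 𝔸ˣ) : 𝔸) := rfl

/-- the flat point is the origin in print's reading too: `B(0) = 0`. [cite: Balaban1985Variational, (156) p.302] -/
@[simp] theorem chartLog_zero (η : ℝ) (D : Domains P) : chartLog η D (0 : PBond P 0 → 𝔸) = 0 := by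
  funext i
  rw [chartLog_apply, expCfg_zero, emlIterU_one, Pi.zero_apply, Units.val_one, mlog_one, smul_zero]

/-- **THE TWO READINGS DIFFER BY THE LEVEL FACTOR**: `chartLog η D A (j, c) = (ηLʲ)·chartQ η D A (j, c)` (`η ≠ 0`). [cite: Balaban1985Variational, (156)-(157) p.302] -/
theorem chartLog_eq_smul_chartQ {η : ℝ} (hη : η ≠ 0) (D : Domains P) (A : PBond P 0 → 𝔸) (i : BondIdx D) :
    chartLog η D A i = ((η : ℂ) * (P.L : ℂ) ^ (i.1.1 : ℕ)) • chartQ η D A i := by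
  rw [chartLog_apply, chartQ_apply, smul_smul]
  congr 1
  have hL : (P.L : ℂ) ≠ 0 := Nat.cast_ne_zero.mpr P.L_pos.ne'
  have hη' : (η : ℂ) ≠ 0 := Complex.ofReal_ne_zero.mpr hη
  field_simp
  rw [Complex.I_sq]
  ring

end PrintReading

end Summit.QuantumFields.YangMills.Theorems.Prop8Chart

end
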